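import Literature.NumberTheory.EllipticCurves.IwasawaDualFunctorialityProofs
import Literature.NumberTheory.EllipticCurves.Kobayashi2003.SignedSelmerModuleFiniteProofs
import Literature.NumberTheory.EllipticCurves.Kobayashi2003.FineSelmerLeSignedSelmerProofs
import Literature.NumberTheory.EllipticCurves.KatoFineSelmerDualMuProofs
import Literature.NumberTheory.EllipticCurves.IwasawaAlgebraDivisibilityProofs
import HarnessLib

/-!
# The dual of `Sel₀(K_∞, E[p^∞]) ≤ Sel^±(E/K_∞)`: a `Λ`-linear SURJECTION `X^±(E/K_∞) ↠ X₀(E/K_∞)` of Pontryagin duals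
# (Kobayashi's `X^± → X₀ → 0`, the definitional end of the four-term sequence (7.21)), for every number field, prime and sign

`Proofs` file (theorems only: no definition, no named fact, no instance, no `sorry`) in the cluster `Kobayashi2003`.
WHY (cell `pub/bsd-wall`; width seat `bsd-wall-tp2-p2-w2` g2 on crux K2r0P stmt-BirchSwinnertonDyer-24945; clause (d) «`k : X⁺ → X₀` onto»
of the LOWER Coleman–Poitou–Tate package `SignedLowerOffTwo.offTwoLower_of_lowerColemanPackageTwo`; the same map was wanted by seat
`bsd-wall-utd-p2-w2` g0 on stmt-BirchSwinnertonDyer-23594). The tree has the inclusion of Selmer groups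
`Kobayashi2003.fineSelmerInfty_le_signedSelmerInfty : Sel₀(K_∞, E[p^∞]) ≤ Sel^ε(E/K_∞)` and the two ABSTRACT dual data
`Kobayashi2003.SignedSelmerDualData` (`X^ε`) and `WeierstrassCurve.FineSelmerDualData` (`X₀`); this file transposes the inclusion into a
`Λ`-linear surjection `X^ε ↠ X₀` through the generic functoriality `IwasawaDual.IsDualPair.exists_linearMap_comp_surjective`, and records the
consequences «`X₀` is a quotient of `X^ε`»: finite generation / torsion / local lengths pass from `X^ε` to `X₀`.

* `inclusion_conjFineSelmerInfty_sub_one` — the inclusion intertwines `conj_γ − 1` on `Sel₀` and on `Sel^ε`.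
* `SignedSelmerDualData.exists_linearMap_toFineDual` — for `γ` a topological generator, every `D : SignedSelmerDualData W κ γ ε` and
  `Y : W.FineSelmerDualData κ γ` admit a `Λ`-linear SURJECTIVE `k : D.X → Y.X` with `Y.toDual (k x) s = D.toDual x s` (`s ∈ Sel₀ ≤ Sel^ε`).
* `SignedSelmerDualData.fineDual_isTorsion`, `…fineDual_lengthAt_le` — `X₀` is `Λ`-torsion if `X^ε` is; `ℓ_𝔭(X₀) ≤ ℓ_𝔭(X^ε)` at every prime.

References: [Kobayashi2003] Def. 1.1 (p. 2), (7.17)–(7.21) (p. 12); [CoatesSujatha2005] §3 (`R(E/F_∞) ⊂ S(E/F_∞)`); [GreenbergLNM1716] §1 p. 60.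
-/

set_option autoImplicit false

noncomputable section

open scoped Classical

universe u

namespace Literature.NumberTheory.EllipticCurves.Kobayashi2003

open Literature.NumberTheory.EllipticCurves Literature.NumberTheory.EllipticCurves.Module
  Literature.NumberTheory.EllipticCurves.IwasawaDual WeierstrassCurve ZpExtension

variable {K : Type u} [Field K] [NumberField K] {W : WeierstrassCurve K} {p : ℕ} [Fact p.Prime]
  {κ : ZpExtension K p} {γ : Field.absoluteGaloisGroup K} {ε : ℤˣ}

/-- The inclusion `Sel₀(K_∞, E[p^∞]) ↪ Sel^ε(E/K_∞)` intertwines `conj_γ − 1` (both are restrictions of `conj_γ − 1` on `H¹(K_∞, E[p^∞])`).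
[cite: Kobayashi2003, Def. 1.1 (sentence following it, p. 2)] -/
theorem inclusion_conjFineSelmerInfty_sub_one [W.IsElliptic] (s : W.fineSelmerInfty κ) :
    AddSubgroup.inclusion (fineSelmerInfty_le_signedSelmerInfty W κ ε) ((W.conjFineSelmerInfty κ γ - 1) s) =
      (conjSignedSelmerInfty W κ ε γ - 1)
        (AddSubgroup.inclusion (fineSelmerInfty_le_signedSelmerInfty W κ ε) s) := by
  apply Subtype.ext
  rw [AddSubgroup.coe_inclusion, WeierstrassCurve.coe_conjFineSelmerInfty_sub_one_apply, IwasawaDual.End_sub_apply,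
    AddMonoid.End.one_apply, AddSubgroupClass.coe_sub, coe_conjSignedSelmerInfty_apply, AddSubgroup.coe_inclusion]

namespace SignedSelmerDualData

/-- **`X^ε(E/K_∞) ↠ X₀(E/K_∞)`, `Λ`-linearly.** For `γ` a topological generator of `Γ = Gal(K_∞/K)`, a dual datum `D` of `Sel^ε(E/K_∞)`
and a dual datum `Y` of `Sel₀(K_∞, E[p^∞])`, there is a SURJECTIVE `Λ`-linear `k : X^ε → X₀` transposing the inclusion
`Sel₀ ≤ Sel^ε` (`fineSelmerInfty_le_signedSelmerInfty`): `Y.toDual (k x) s = D.toDual x s` for `s ∈ Sel₀`. Generic functoriality of dual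
pairs (`IsDualPair.exists_linearMap_comp_surjective`; `ℚ/ℤ` divisible) applied to `D.isDualPair`, `Y.isDualPair`. This is the map
`X^± → X₀ → 0` of Kobayashi's (7.21) / Kato's §17.13, for every `K`, `p`, `ε`. [cite: Kobayashi2003, (7.17)–(7.21) (p. 12)]
[cite: CoatesSujatha2005, §3] -/
theorem exists_linearMap_toFineDual [W.IsElliptic] (hγ : κ.IsTopGenerator γ) (D : SignedSelmerDualData W κ γ ε)
    (Y : W.FineSelmerDualData κ γ) :
    ∃ k : D.X →ₗ[IwasawaAlgebra p] Y.X, Function.Surjective k ∧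
      ∀ (x : D.X) (s : W.fineSelmerInfty κ),
        Y.toDual (k x) s = D.toDual x (AddSubgroup.inclusion (fineSelmerInfty_le_signedSelmerInfty W κ ε) s) :=
  (D.isDualPair hγ).exists_linearMap_comp_surjective (Y.isDualPair hγ)
    (AddSubgroup.inclusion (fineSelmerInfty_le_signedSelmerInfty W κ ε))
    (fun s ↦ inclusion_conjFineSelmerInfty_sub_one s) (AddSubgroup.inclusion_injective _)

/-- **`X₀` is `Λ`-torsion when `X^ε` is** (a quotient of a torsion module). [cite: Kobayashi2003, (7.21) (p. 12)] -/
theorem fineDual_isTorsion [W.IsElliptic] (hγ : κ.IsTopGenerator γ) (D : SignedSelmerDualData W κ γ ε)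
    (Y : W.FineSelmerDualData κ γ) (hX : Module.IsTorsion (IwasawaAlgebra p) D.X) :
    Module.IsTorsion (IwasawaAlgebra p) Y.X := by
  obtain ⟨k, hk, -⟩ := D.exists_linearMap_toFineDual hγ Y
  intro y
  obtain ⟨x, rfl⟩ := hk y
  obtain ⟨a, ha⟩ := @hX x
  exact ⟨a, by rw [Submonoid.smul_def, ← map_smul, ← Submonoid.smul_def, ha, map_zero]⟩

/-- **`ℓ_𝔭(X₀) ≤ ℓ_𝔭(X^ε)` at every prime `𝔭` of `Λ`** (a quotient has smaller local length). [cite: Kobayashi2003, (7.21) (p. 12)] -/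
theorem fineDual_lengthAt_le [W.IsElliptic] (hγ : κ.IsTopGenerator γ) (D : SignedSelmerDualData W κ γ ε)
    (Y : W.FineSelmerDualData κ γ) (𝔭 : PrimeSpectrum (IwasawaAlgebra p)) :
    lengthAt (IwasawaAlgebra p) Y.X 𝔭 ≤ lengthAt (IwasawaAlgebra p) D.X 𝔭 := by
  obtain ⟨k, hk, -⟩ := D.exists_linearMap_toFineDual hγ Y
  exact lengthAt_le_of_surjective k hk 𝔭

/-- **`X₀` is finitely generated over `Λ`** for every `γ`-pair carrying a signed dual datum (a quotient of the finitely generated `X^ε`,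
`SignedSelmerDualData.moduleFinite`). [cite: Kobayashi2003, Thm. 1.2 (p. 2) and (7.21)] -/
theorem fineDual_moduleFinite [W.IsElliptic] (hγ : κ.IsTopGenerator γ) (D : SignedSelmerDualData W κ γ ε)
    (Y : W.FineSelmerDualData κ γ) : Module.Finite (IwasawaAlgebra p) Y.X := by
  haveI : Module.Finite (IwasawaAlgebra p) D.X := D.moduleFinite hγ
  obtain ⟨k, hk, -⟩ := D.exists_linearMap_toFineDual hγ Y
  exact Module.Finite.of_surjective k hk

end SignedSelmerDualData

end Literature.NumberTheory.EllipticCurves.Kobayashi2003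

end
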